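import Summits.BirchSwinnertonDyer.BirchSwinnertonDyer.Theses.TwoAdicConverse
import Summits.BirchSwinnertonDyer.BirchSwinnertonDyer.Theorems.KolyvaginRankRigidityAtTwoKolyvaginCorankLowerBoundAtTwoRichOfProp37
import Summits.BirchSwinnertonDyer.BirchSwinnertonDyer.Theorems.KolyvaginRankRigidityAtTwoFullClassDeepeningAtTwoOfProp37
import Summits.BirchSwinnertonDyer.BirchSwinnertonDyer.Theorems.KolyvaginRankRigidityAtTwoStrongNonzeroSystemOfSeedTransport
import Summits.BirchSwinnertonDyer.BirchSwinnertonDyer.Theorems.TwoAdicConverseNoTwoTorsionOverK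
import HarnessLib

/-!
# Route `TwoAdicConverse` (rung S3), residual `RankOneTwoConverse` (stmt-19220) and crux V1′
# `KolyvaginNonvanishingAtTwoFrame` (stmt-24622) — BY NAME from the two open inputs of route
# `KolyvaginRankRigidityAtTwo`: Kolyvagin's Conjecture A at 2 (U1, stmt-28083) and Gross 1991
# Prop. 3.7 (2) (print, stmt-23091)

LEAD `bsd-line-krr2-p1` gen 12 (key row [24623, 24897, 24622]). Route `TwoAdicConverse` still carries the
r = 1 half of the S3 leaf in the OLD currency: top-level cruxes V1′ `KolyvaginNonvanishingAtTwoFrame`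
(24622) and V2♭ `KolyvaginCorankLowerBoundAtTwo` (24623, plain lossless form) feeding the landed glue
`RankOneTwoConverseGlueV2` (24897). On route `KolyvaginRankRigidityAtTwo` (KRR2) the same half was re-keyed
(R4-∞, rev 26–34) to the RICH pair V1′∞ `KolyvaginStrongNonzeroSystemAtTwo` (27983 = U1 28083 ∧ U2 28084,
glue 28085 PROVED) / V2♭∞ `KolyvaginCorankLowerBoundAtTwoRich` (27984), and BOTH U2 and V2♭∞ are landed
theorems modulo the single print fact `GrossLMS1991.prop37_2_frobeniusCongruence` (p642176, p641767).
This file transports that state to `TwoAdicConverse` by name: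

* `kolyvaginNonvanishingAtTwoFrame_of_strongNonzeroSystem` : V1′∞ (KRR2 27983) ⇒ V1′ (24622) — the
  `θ = 1, k = 0` instance of the strong system;
* `kolyvaginNonvanishingAtTwoFrame_of_conjA_of_prop37` : U1 ⇒ Prop 3.7 (2) ⇒ V1′ (24622) — the crux
  24622 is PROVED MODULO {Conjecture A at 2, Gross 3.7 (2)} (conditional; it does not close 24622);
* `rankOneTwoConverse_of_strongNonzeroSystem_of_rich` : V1′∞ ⇒ V2♭∞ ⇒ `RankOneTwoConverseOffBigImage`
  (24404) ⇒ `PrintedInputsRankOneAtTwo` (23951) ⇒ `RankOneTwoConverse` (19220), with `NoTwoTorsionOverK`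
  (24405) DISCHARGED by the landed `twoAdicConverse_noTwoTorsionOverK_proof` — the r = 1 branch of KRR2's
  deciding theorem replayed on this route's decls (2-parity ⇒ w = −1; Hoffstein–Luo Heegner field with
  `2` split, `d_K ≡ 1 (mod 8)`, `L(E^(d_K),1) ≠ 0`; Kolyvagin–Kato ⇒ corank 0 for the twist; the least
  RICH depth ν; V2♭∞ ⇒ ν + 1 ≤ 1; ν = 0 ⇒ `c_M(1) ≠ 0` ⇒ Gross–Zagier ⇒ analytic rank 1);
* `rankOneTwoConverse_of_conjA_of_prop37` : **19220 ⇐ {U1 28083, print 23091, residual 24404, printed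
  inputs 23951}** — four hypotheses, all existing items (no BFH 25006, no 19921, no KRR2 residual 24303);
* `rankOneTwoConverseGlueV3` : the same as a closed glue text
  `U1 → Prop37 → Off → PrintedInputs → NoTwoTorsion → RankOneTwoConverse` (children order), which a
  planner may file as the v3 split of 19220 (children 28083 · 23091 · 24404 · 23951 · 24405, all existing
  items; 24622 / 24623 then go aside on this route as they did on KRR2).

HONEST FRAMING. Conditional theorems (hypotheses = route items / one named print fact, D-0014). Nothing
here closes 24622, 24623, 19220, U1 28083 or the print item 23091; V2♭ 24623 (plain form) is NOT implied by
V2♭∞ and is not touched. No summit, rung or leaf is proved; the Birch–Swinnerton-Dyer conjecture is NOT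
proved by this. `--supports` stmt-BirchSwinnertonDyer-24622.
References: [cite: Kolyvagin1991MathAnn, §2 Conj. A, Thm. 2.2–2.3] [cite: GrossLMS1991, Prop. 3.7 (2)]
[cite: WZhang2014, Thm. 1.1] [cite: GrossZagier1986, I (6.1)] [cite: HoffsteinLuo1997, Thm. 1]
[cite: DokchitserDokchitser2010, Thm. 1.4].
-/

set_option autoImplicit false
-- the Theorems namespace of this sub repeats the summit name by design (D-0017 nested layout)
set_option linter.dupNamespace false

noncomputable section

open scoped Classical

open Summit.BirchSwinnertonDyer.BirchSwinnertonDyer.Theses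
open Literature.NumberTheory.EllipticCurves.GrossLMS1991 (prop37_2_frobeniusCongruence)

namespace Summit.BirchSwinnertonDyer.BirchSwinnertonDyer.Theorems.TwoAdicConverseOfConjA

/-- **V1′∞ ⇒ V1′**: KRR2's strong non-zero system (item 27983: a depth `r` carrying, for every index
margin `θ·M + k ≤ M(n)`, a non-zero Kolyvagin class at `2`) gives route `TwoAdicConverse`'s crux V1′
(item 24622: some non-zero class `c_M(n) ≠ 0` with `1 ≤ M ≤ M(n)`) — the instance `θ = 1, k = 0`.
[cite: Kolyvagin1991MathAnn, §2 (2.1), Conj. A] -/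
theorem kolyvaginNonvanishingAtTwoFrame_of_strongNonzeroSystem
    (hV1 : KolyvaginRankRigidityAtTwo.KolyvaginStrongNonzeroSystemAtTwo) :
    TwoAdicConverse.KolyvaginNonvanishingAtTwoFrame := by
  unfold TwoAdicConverse.KolyvaginNonvanishingAtTwoFrame
  intro W _ _ hCM hred hsur K _ _ hK _ hHN hodd hne3 htor hH2 Dt β ι hβ
  obtain ⟨r, hr⟩ := hV1 W hCM hred hsur K hK hHN hodd hne3 htor hH2 Dt β ι hβ
  obtain ⟨n, d, M, hn, -, hM, hle, hne⟩ := hr 1 0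
  exact ⟨n, d, M, hn, hM, by simpa using hle, hne⟩

/-- **Crux V1′ (24622) modulo Conjecture A at 2 and Gross 3.7 (2)**: U1 `KolyvaginBoundedDefectAtTwo`
(28083) and `prop37_2_frobeniusCongruence` (23091) give V1′ — through KRR2's landed glue 28085
(`strongNonzeroSystemOfSeedTransport_proof`) and U2 from Prop 3.7 (2) (`fullClassDeepeningAtTwo_of_prop37`).
CONDITIONAL; does not close 24622. [cite: Kolyvagin1991MathAnn, §2 Conj. A] [cite: GrossLMS1991, Prop. 3.7 (2)] -/
theorem kolyvaginNonvanishingAtTwoFrame_of_conjA_of_prop37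
    (hU1 : KolyvaginRankRigidityAtTwo.KolyvaginBoundedDefectAtTwo) (h37 : prop37_2_frobeniusCongruence) :
    TwoAdicConverse.KolyvaginNonvanishingAtTwoFrame :=
  kolyvaginNonvanishingAtTwoFrame_of_strongNonzeroSystem
    (KolyvaginRigidity.strongNonzeroSystemOfSeedTransport_proof hU1
      (KolyvaginLowerBoundAtTwo.fullClassDeepeningAtTwo_of_prop37 h37))

/-- **S3's residual `RankOneTwoConverse` (19220) from the RICH pair of KRR2** — V1′∞ (27983), V2♭∞ (27984)
— together with this route's residual `RankOneTwoConverseOffBigImage` (24404) and printed inputs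
`PrintedInputsRankOneAtTwo` (23951); `NoTwoTorsionOverK` (24405) is discharged by its landed proof. The
r = 1 branch of KRR2's deciding theorem on this route's decls: 2-parity gives `w(E) = −1`; Hoffstein–Luo
(with modularity) a Heegner field `K` with `2` split, `d_K ≡ 1 (mod 8)` and `L(E^(d_K),1) ≠ 0`;
Kolyvagin–Kato finiteness gives `corank Sel_{2^∞}(E^(d_K)) = 0`; V1′∞ a rich depth, `Nat.find` the least
one `ν`; V2♭∞ gives `ν + 1 ≤ 1 ∨ ν + 1 ≤ 0`, so `ν = 0`, `n = 1`, `c_M(1) ≠ 0`; Gross–Zagier over `K` and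
`L(E/K) = L(E)·L(E^(d_K))` give analytic rank `1`. [cite: Kolyvagin1991MathAnn, Thm. 2.2–2.3]
[cite: WZhang2014, Thm. 1.1 (shape at p ≥ 5)] [cite: GrossZagier1986, I (6.1)] -/
theorem rankOneTwoConverse_of_strongNonzeroSystem_of_rich
    (hV1 : KolyvaginRankRigidityAtTwo.KolyvaginStrongNonzeroSystemAtTwo)
    (hV2 : KolyvaginRankRigidityAtTwo.KolyvaginCorankLowerBoundAtTwoRich)
    (hOff : TwoAdicConverse.RankOneTwoConverseOffBigImage)
    (hIn : TwoAdicConverse.PrintedInputsRankOneAtTwo) :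
    TwoAdicConverse.RankOneTwoConverse := by
  have hT : TwoAdicConverse.NoTwoTorsionOverK :=
    KolyvaginRankRigidity.twoAdicConverse_noTwoTorsionOverK_proof
  unfold TwoAdicConverse.RankOneTwoConverse
  unfold TwoAdicConverse.RankOneTwoConverseOffBigImage at hOff
  unfold TwoAdicConverse.PrintedInputsRankOneAtTwo at hIn
  unfold TwoAdicConverse.NoTwoTorsionOverK at hT
  intro W _ _ hCM hred hc
  by_cases hsur : (∀ m : ℕ, W.HasSurjectiveModNGaloisRep (2 ^ m : ℕ))
  swap
  · exact hOff W hCM hred hsur hc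
  obtain ⟨hmod, hHL, hpar, hKato, hE, hGZ, hrec⟩ := hIn
  haveI : Fact (Nat.Prime 2) := ⟨Nat.prime_two⟩
  haveI : NeZero (W.conductorNorm ℤ) := ⟨(W.conductorNorm_pos_holds).ne'⟩
  -- root number −1 from 2-parity (Dokchitser–Dokchitser) and corank 1
  have hw : W.rootNumber = -1 := by
    have h := hpar W
    unfold Literature.NumberTheory.EllipticCurves.p_parity at h
    rw [hc, pow_one] at h
    exact h.symm
  -- Heegner field K with 2 split, d_K ≡ 1 (mod 8), and L(E^(d_K), 1) ≠ 0 (Hoffstein–Luo)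
  obtain ⟨K, _, _, hK, -, hHN, hH2, hd8, hL1⟩ :=
    Literature.NumberTheory.EllipticCurves.exists_heegnerField_split_twist_ne_zero_discr_emod_eight_of_hoffsteinLuo
      hmod hHL W hw Nat.prime_two 0
  have hodd : Odd (NumberField.discr K) := by
    rw [Int.odd_iff]; omega
  have hne3 : NumberField.discr K ≠ -3 := by omega
  have hne4 : NumberField.discr K ≠ -4 := by omega
  have h2d : ¬ ((2 : ℤ) ∣ NumberField.discr K) := by omega
  have hd : (NumberField.discr K : ℚ) ≠ 0 := by exact_mod_cast NumberField.discr_ne_zero K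
  haveI := W.isElliptic_quadraticTwist hd
  -- the partner twist has L(1) ≠ 0, hence (Kolyvagin–Gross–Zagier finiteness) 2-Selmer corank 0
  obtain ⟨-, -, hfin⟩ := hKato (W.quadraticTwist (NumberField.discr K : ℚ)) hL1
  haveI := hfin
  have hc' : (W.quadraticTwist (NumberField.discr K : ℚ)).selmerCorank 2 = 0 :=
    (W.quadraticTwist (NumberField.discr K : ℚ)).selmerCorank_eq_zero_of_finite 2
  have htor := hT W hsur K hK
  -- the FRAME (Dt, β, ι): modularity ⇒ a parametrisation datum (PROVED supply); an orientation β; any ι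
  obtain ⟨fW, hfW⟩ := hmod W
  obtain ⟨Dt⟩ :=
    Literature.NumberTheory.Automorphic.nonempty_modularParametrizationData_of_isNewformOf hfW
  obtain ⟨β, hβ⟩ :=
    Literature.NumberTheory.EllipticCurves.exists_dvd_sq_sub_discr_holds (W.conductorNorm ℤ) K hK hHN
  obtain ⟨ι⟩ := (inferInstance : Nonempty (K →+* ℂ))
  -- V1′∞: a RICH depth r; take the least rich depth ν
  obtain ⟨r, hr⟩ := hV1 W hCM hred hsur K hK hHN hodd hne3 htor hH2 Dt β ι hβ
  have hex : ∃ ν : ℕ, ∀ θ k : ℕ, ∃ (n : ℕ)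
      (d : Literature.NumberTheory.EllipticCurves.KolyvaginHeegnerData Dt β ι n) (M : ℕ),
      Literature.NumberTheory.EllipticCurves.KolyvaginDescent.KolSupp
        (Literature.NumberTheory.EllipticCurves.Zhang2014.IsKolyvaginPrime (W.conductorNorm ℤ) W K 2) n ∧
      n.primeFactors.card = ν ∧ 1 ≤ M ∧
      ((θ * M + k : ℕ) : ℕ∞) ≤ Literature.NumberTheory.EllipticCurves.Zhang2014.levelIndex W 2 n ∧
      d.kolyvaginClass Nat.prime_two M ≠ 0 := ⟨r, hr⟩
  have hrich := Nat.find_spec hex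
  have hbelow : ∀ ν' : ℕ, ν' < Nat.find hex → ∃ θ k : ℕ, ∀ (n' : ℕ)
      (d' : Literature.NumberTheory.EllipticCurves.KolyvaginHeegnerData Dt β ι n') (M' : ℕ),
      Literature.NumberTheory.EllipticCurves.KolyvaginDescent.KolSupp
        (Literature.NumberTheory.EllipticCurves.Zhang2014.IsKolyvaginPrime (W.conductorNorm ℤ) W K 2) n' →
      1 ≤ M' →
      ((θ * M' + k : ℕ) : ℕ∞) ≤ Literature.NumberTheory.EllipticCurves.Zhang2014.levelIndex W 2 n' →
      n'.primeFactors.card = ν' → d'.kolyvaginClass Nat.prime_two M' = 0 := by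
    intro ν' hν'
    have h := Nat.find_min hex hν'
    rw [not_forall] at h
    obtain ⟨θ, h⟩ := h
    rw [not_forall] at h
    obtain ⟨k, hθk⟩ := h
    exact ⟨θ, k, fun n' d' M' hn' hM' hle hcard ↦ by
      by_contra hne'; exact hθk ⟨n', d', M', hn', hcard, hM', hle, hne'⟩⟩
  -- V2♭∞ (the ONLY use): ν + 1 ≤ c = 1 ∨ ν + 1 ≤ c′ = 0 forces ν = 0, i.e. y_K is non-torsion
  have hstruct := hV2 W hCM hred hsur K hK hne3 hne4 h2d hHN Dt β ι (Nat.find hex) hrich hbelow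
  have hν : Nat.find hex = 0 := by
    rcases hstruct with h1 | h1 <;> omega
  rw [hν] at hrich
  obtain ⟨n₀, d₀, M₀, hn₀, hν0, hM₀, -, hne₀⟩ := hrich 0 0
  have hn1 : n₀ = 1 := by
    rw [Finset.card_eq_zero, Nat.primeFactors_eq_empty] at hν0
    rcases hν0 with h0 | h1
    · exact absurd (h0 ▸ hn₀.1) not_squarefree_zero
    · exact h1
  subst hn1
  -- Gross–Zagier over K: ord_(s=1) L(E/K, s) = 1, and L(E/K) = L(E) · L(E^(d_K)) with L(E^(d_K), 1) ≠ 0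
  have hEK : Literature.NumberTheory.EllipticCurves.analyticRankEK W K = 1 :=
    Literature.NumberTheory.EllipticCurves.heegnerSystem_analyticRankEK_eq_one_of_kolyvaginClass_one_ne_zero
      (hGZ W _ K) (hrec _ W K) hK rfl hHN d₀ hne₀
  rw [Literature.NumberTheory.EllipticCurves.analyticRankEK_eq_add_of hE W K,
    Literature.NumberTheory.EllipticCurves.analyticRank_eq_zero_of_entireLFunction_one_ne_zero _ hL1,
    add_zero] at hEK
  exact hEK

/-- **S3's residual `RankOneTwoConverse` (19220) from exactly four existing items: Conjecture A at 2
(U1 28083), Gross 1991 Prop. 3.7 (2) (print 23091), the off-big-image residual (24404) and the printed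
inputs (23951)** — V1′∞ := glue 28085 ∘ U2-from-Prop-3.7(2), V2♭∞ := `KolyvaginCorankLowerBoundAtTwoRich_of_prop37`.
CONDITIONAL; nothing is closed; BSD is not proved by this. [cite: Kolyvagin1991MathAnn, §2 Conj. A, Thm. 2.2–2.3]
[cite: GrossLMS1991, Prop. 3.7 (2)] -/
theorem rankOneTwoConverse_of_conjA_of_prop37
    (hU1 : KolyvaginRankRigidityAtTwo.KolyvaginBoundedDefectAtTwo) (h37 : prop37_2_frobeniusCongruence)
    (hOff : TwoAdicConverse.RankOneTwoConverseOffBigImage)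
    (hIn : TwoAdicConverse.PrintedInputsRankOneAtTwo) :
    TwoAdicConverse.RankOneTwoConverse :=
  rankOneTwoConverse_of_strongNonzeroSystem_of_rich
    (KolyvaginRigidity.strongNonzeroSystemOfSeedTransport_proof hU1
      (KolyvaginLowerBoundAtTwo.fullClassDeepeningAtTwo_of_prop37 h37))
    (KolyvaginLowerBoundAtTwo.KolyvaginCorankLowerBoundAtTwoRich_of_prop37 h37) hOff hIn

/-- **Glue text v3 for the split of 19220** (children order U1 · Prop 3.7 (2) · Off · PrintedInputs ·
NoTwoTorsion ⟹ parent), as a closed term a planner can file verbatim; the `NoTwoTorsionOverK` binder is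
accepted and unused (it is a landed theorem). [cite: Kolyvagin1991MathAnn, §2] [cite: GrossLMS1991, Prop. 3.7 (2)] -/
theorem rankOneTwoConverseGlueV3 :
    KolyvaginRankRigidityAtTwo.KolyvaginBoundedDefectAtTwo → prop37_2_frobeniusCongruence →
      TwoAdicConverse.RankOneTwoConverseOffBigImage → TwoAdicConverse.PrintedInputsRankOneAtTwo →
      TwoAdicConverse.NoTwoTorsionOverK → TwoAdicConverse.RankOneTwoConverse :=
  fun hU1 h37 hOff hIn _ ↦ rankOneTwoConverse_of_conjA_of_prop37 hU1 h37 hOff hIn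

end Summit.BirchSwinnertonDyer.BirchSwinnertonDyer.Theorems.TwoAdicConverseOfConjA

end
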